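import Mathlib
import Summits.Ventures.PercRepro2.FiveTypedCore
import Summits.Ventures.PercRepro2.SortedPairs5

/-!
# Five typed edges, modulo the finite statements (blind cell PercRepro2, night-3, 2026-08-24)

Row 2′TRI for FIVE typed edges with the finite cores factored out: `typedCount_quint_K3_nonneg`
proves `0 ≤ typedCount {e₁, …, e₅} z τ K₃` FROM `allOk4 = true` (the four-edge finite statement,
for the inert-edge reductions) and `allOk5 = true` (`FiveTypedAbstract.lean`).  The edges are
re-ordered and re-oriented to the SORTED member of their orbit (`exists_sorted5`), which leaves the
count unchanged; the sorted labelling is canonical, so it is one of the enumerated ones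
(`okQ5_of_canon`), and its thirty-two table tests give the thirty-two kernel sums (`cube_states5`,
`okQ5_ineq_t`, `typedCount_quint`).
-/

namespace Summit.Ventures.PercRepro2

open UnionCluster

namespace CovForm

namespace TwoTyped

open OneTyped TypedRed

section Main5

open Classical

variable {V : Type*} {E : Type*} [Fintype E] [DecidableEq E] {R : Type*} [Field R]
  [LinearOrder R] [IsStrictOrderedRing R]
variable (ends : E → Sym2 V) (o a₁ a₂ a₃ b : V)


/-- **Five typed edges, modulo the finite statements**: for any five distinct typed edges the typed
count of `K₃` is nonnegative — the ends are re-ordered and re-oriented to the sorted member of their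
orbit (`exists_sorted5`), which does not change the count. -/
theorem typedCount_quint_K3_nonneg (hall4 : allOk4 = true) (hall5 : allOk5 = true) (e : Fin 5 → E)
    (hinj : Function.Injective e) (z : Config E) (τ : E → ℕ) (hτ : ∀ i, τ (e i) = 1 ∨ τ (e i) = 2) :
    0 ≤ typedCount (Finset.univ.image e) z τ (K3 ends o a₁ a₂ a₃ b : Config E → Config E → Config E → R) := by
  have hex : ∀ i : Fin 5, ∃ p : V × V, ends (e i) = s(p.1, p.2) := fun i => by
    obtain ⟨⟨u, w⟩, h⟩ := Quot.exists_rep (ends (e i))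
    exact ⟨(u, w), h.symm⟩
  choose ps hps using hex
  obtain ⟨σ, fl, hsort⟩ := exists_sorted5 ends o a₁ a₂ a₃ b (closedOn (Finset.univ.image e) z) ps
  have hF : Finset.univ.image e = ({e (σ 0), e (σ 1), e (σ 2), e (σ 3), e (σ 4)} : Finset E) := by
    rw [← Finset.image_univ_of_surjective σ.surjective, Finset.image_image]
    ext x
    simp only [Finset.mem_image, Finset.mem_univ, true_and, Finset.mem_insert, Finset.mem_singleton,
      Function.comp]
    constructor
    · rintro ⟨i, rfl⟩
      fin_cases i <;> simp
    · rintro (rfl | rfl | rfl | rfl | rfl) <;> exact ⟨_, rfl⟩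
  have hends' : ∀ i, ends (e (σ i)) = s((act5 σ fl ps i).1, (act5 σ fl ps i).2) := by
    intro i
    simp only [act5]
    split_ifs
    · rw [hps (σ i), Sym2.eq_swap]
    · exact hps (σ i)
  have hne : ∀ i j : Fin 5, i ≠ j → e (σ i) ≠ e (σ j) := fun i j hij h =>
    hij (σ.injective (hinj h))
  rw [hF] at hsort ⊢
  refine typedCount_quint_core ends o a₁ a₂ a₃ b hall4 hall5 (e (σ 0)) (e (σ 1)) (e (σ 2)) (e (σ 3)) (e (σ 4))
    (hne 0 1 (by decide)) (hne 0 2 (by decide)) (hne 0 3 (by decide)) (hne 0 4 (by decide))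
    (hne 1 2 (by decide)) (hne 1 3 (by decide)) (hne 1 4 (by decide)) (hne 2 3 (by decide))
    (hne 2 4 (by decide)) (hne 3 4 (by decide)) z τ ?_ (hτ _) (hτ _) (hτ _) (hτ _) (hτ _) (act5 σ fl ps)
    (hends' 0) (hends' 1) (hends' 2) (hends' 3) (hends' 4) hsort
  intro e' he'
  simp only [Finset.mem_insert, Finset.mem_singleton] at he'
  rcases he' with rfl | rfl | rfl | rfl | rfl <;> exact hτ _

/-- **`TypedBases` for at most five typed edges**, modulo `allOk4 = true` and `allOk5 = true`. -/
theorem typedCount_nonneg_of_card_le_five (hall4 : allOk4 = true) (hall5 : allOk5 = true) (F : Finset E)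
    (hF : F.card ≤ 5) (z : Config E) (τ : E → ℕ) (hτ : ∀ e ∈ F, τ e = 1 ∨ τ e = 2) :
    0 ≤ typedCount F z τ (K3 ends o a₁ a₂ a₃ b : Config E → Config E → Config E → R) := by
  rcases Nat.lt_or_ge F.card 5 with h | h
  · exact typedCount_nonneg_of_card_le_four ends o a₁ a₂ a₃ b hall4 F (by omega) z τ hτ
  · have h5 : F.card = 5 := by omega
    let eq : F ≃ Fin 5 := (Finset.equivFin F).trans (finCongr h5)
    let e : Fin 5 → E := fun i => (eq.symm i).1
    have hinj : Function.Injective e := fun i j h => eq.symm.injective (Subtype.ext h)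
    have hF : Finset.univ.image e = F := by
      ext x
      simp only [Finset.mem_image, Finset.mem_univ, true_and]
      constructor
      · rintro ⟨i, rfl⟩
        exact (eq.symm i).2
      · intro hx
        exact ⟨eq ⟨x, hx⟩, by simp [e]⟩
    rw [← hF]
    exact typedCount_quint_K3_nonneg ends o a₁ a₂ a₃ b hall4 hall5 e hinj z τ
      (fun i => hτ (e i) (eq.symm i).2)

end Main5

end TwoTyped

end CovForm

end Summit.Ventures.PercRepro2
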